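import Summits.CriticalPhenomena.PercolationContinuityZ3.Theorems.PercNearOneGluingNearOneGluingHoleResampling

/-!
# Crux `PercNearOneGluing.NearOneGluing` (stmt-CriticalPhenomena-4574), line `SketchR2I5` —
# the hole-resampling (telescoping) reduction of S1-gen to the hole-averaged exchange covariance (part II)

Lead prover-line-stmt-CriticalPhenomena-4574-c7 (cycle 7, wave 4, stub-worker W7).  Lands
`--supports stmt-CriticalPhenomena-4574`; no definitions, no named facts.

## Content

Finite weighted graph on `Fin n`, `μ = prodBernoulli w` (`weight` = its atom weights), `C_v(ω) = openEdgeCluster ω v`,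
`D := {y ↮ z}`, `D_a := {x↮y} ∩ {x↮z}`, `W := D_a ∩ {o↔x}`; `V̄(C)` = the pairs meeting `{v} ∪ V(C)` (BHK's `W̄` for the
source `v`).  Given `C_z = Z` on `D`, the configuration off `Z̄` is fresh (domain Markov property, BHK display (10),
`BHK2006.sum_cond_cluster`), so with the **hole average** `(A G)(Z) := Σ_η weight(η) G(C_y(η ∖ Z̄))` and the
**hole-resampling operator** `(T G)(C) := Σ_η weight(η) (A G)(C_z(η ∖ C̄))` (resample everything outside the closed
cluster of `z`, read off the new cluster of `y`; a reversible Markov operator on increasing functions of `C_y`):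

* (part I, `…HoleResampling`) `tel_identity`:  `S(G) − S(T G) = μ(D)·INNER(G)`, where `S(G) := μ(D)·E[φ G(C_y); D] − E[φ; D]·E[G(C_y); D]` is the
  S1-gen slack (`φ := μ(D_a)·1{o↔y} − μ(W)·1{x↔y}`, i.e. `S(G) = μ(D_a)μ(D)²·[Cov_D(1{o↔y},G) − θ Cov_D(1{x↔y},G)]`) and
  `INNER(G) := E[φ G(C_y); D] − E[(Aφ)(C_z)·(AG)(C_z); D]` is the hole-averaged UNCONDITIONED covariance
  `Σ_Z μ(C_z = Z; D)·Cov_{G−V(Z)}(φ, G)`;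
  (part I also has `tel_monotone_T`, the Doeblin contraction `tel_contract`, `tel_S_iter`, `tel_S_lower`);
* (this file) `exchS1_gen_of_innerHole`: if `INNER(H) ≥ 0` for every increasing `H` then S1-gen holds for every increasing
  `G` (all weights `< 1`): `S(G) = μ(D) Σ_{k<K} INNER(T^k G) + S(T^K G) ≥ S(T^K G) ≥ −2ρ^K (G(univ) − G(∅)) → 0`,
  `ρ = 1 − weight(∅) < 1`.
Together with `exchS2_of_exchS1_gen`, `exchS1_of_exchS1_gen` (tree file `…S2OfS1Gen`) the `|A| = 3` case of
Kozma–Nitzan's Question 7 is reduced to the single residual `INNER ≥ 0` (worker report CexchS1.md §3; 0 violations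
in ≈ 10⁶ exact instances, n ≤ 9, and for all up-sets of vertex- and edge-clusters, n ≤ 8).
[cite: VandenbergHaggstromKahn2005, §1 pp. 7–8, display (10)] [cite: KozmaNitzan2024, Question 7 (p. 36)]
-/

namespace Summit.CriticalPhenomena.PercolationContinuityZ3.Theorems

open MeasureTheory Set Literature.Probability.LatticeModels Literature.Probability.Percolation
open Literature.Probability.Percolation.BHK2006
open scoped Classical
open Q7ThreeCut
open DecisionTree (ind ind_of_mem ind_of_not_mem ind_nonneg)

noncomputable section

variable {n : ℕ}

/-- `wt⟦w⟧ η`: the atom weight of the configuration `η` under `prodBernoulli w` (file-local notation for the tree term). -/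
local notation3 (prettyPrint := false) "wt⟦" w "⟧" => weight (fun e => ((w : Sym2 (Fin _) → unitInterval) e : ℝ))

/-- `bar⟦v, C⟧`: BHK's `C̄` for the source `v` — the pairs meeting `{v} ∪ V(C)` (file-local notation for the tree term). -/
local notation3 (prettyPrint := false) "bar⟦" v ", " C "⟧" => {e : Sym2 (Fin _) | ∃ u ∈ e, u = v ∨ ∃ e' ∈ (C : Set (Sym2 (Fin _))), u ∈ e'}

/-- `hole⟦w, y, z, G⟧ Z`: the hole average `(A G)(Z) = Σ_η weight(η)·G(C_y(η ∖ Z̄))` (file-local notation). -/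
local notation3 (prettyPrint := false) "hole⟦" w ", " y ", " z ", " G "⟧" =>
  fun Z : Set (Sym2 (Fin _)) => ∑ η : Set (Sym2 (Fin _)), wt⟦w⟧ η * (G : Set (Sym2 (Fin _)) → ℝ) (openEdgeCluster (η \ bar⟦z, Z⟧) y)

/-- `resam⟦w, y, z, G⟧ C`: the hole-resampling operator `(T G)(C) = Σ_η weight(η)·(A G)(C_z(η ∖ C̄))` (file-local notation). -/
local notation3 (prettyPrint := false) "resam⟦" w ", " y ", " z ", " G "⟧" =>
  fun C : Set (Sym2 (Fin _)) => ∑ η : Set (Sym2 (Fin _)), wt⟦w⟧ η * (hole⟦w, y, z, G⟧) (openEdgeCluster (η \ bar⟦y, C⟧) z)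

/-! ### Integrals against `prodBernoulli` as weighted sums -/

/-- A set integral against `prodBernoulli w` is the weighted finite sum with the indicator. [folklore] -/
theorem tel_setIntegral_eq_sum (w : Sym2 (Fin n) → unitInterval) (S : Set (BondConfig (Fin n)))
    (h : BondConfig (Fin n) → ℝ) :
    ∫ ω in S, h ω ∂(prodBernoulli w) = ∑ ω, wt⟦w⟧ ω * (h ω * ind S ω) := by
  rw [← integral_indicator (MeasurableSet.of_discrete : MeasurableSet S), integral_prodBernoulli_eq_sum]
  refine Finset.sum_congr rfl fun ω _ => ?_
  by_cases hω : ω ∈ S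
  · rw [Set.indicator_of_mem hω, ind_of_mem hω, mul_one]
  · rw [Set.indicator_of_notMem hω, ind_of_not_mem hω]; ring

/-- The probability of an event under `prodBernoulli w` is the weighted sum of its indicator. [folklore] -/
theorem tel_measureReal_eq_sum (w : Sym2 (Fin n) → unitInterval) (S : Set (BondConfig (Fin n))) :
    (prodBernoulli w).real S = ∑ ω, wt⟦w⟧ ω * ind S ω := by
  rw [← integral_indicator_one (MeasurableSet.of_discrete : MeasurableSet S), integral_prodBernoulli_eq_sum]
  refine Finset.sum_congr rfl fun ω _ => ?_
  by_cases hω : ω ∈ S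
  · rw [Set.indicator_of_mem hω, ind_of_mem hω, Pi.one_apply]
  · rw [Set.indicator_of_notMem hω, ind_of_not_mem hω, mul_zero]

/-- The weight of the empty configuration is positive when all weights are `< 1`. [folklore] -/
theorem tel_weight_empty_pos (w : Sym2 (Fin n) → unitInterval) (hw : ∀ e, (w e : ℝ) < 1) :
    0 < wt⟦w⟧ (∅ : Set (Sym2 (Fin n))) := by
  unfold weight
  refine Finset.prod_pos fun e _ => ?_
  rw [if_neg (Set.notMem_empty e)]
  linarith [hw e]

/-! ### S1-gen from the nonnegativity of the hole-averaged exchange covariance -/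

/-- **The telescoping reduction.**  Let all weights be `< 1`, and put `φ(C) := μ(D_a)·F_{y,o}(C) − μ(W)·F_{y,x}(C)`
(`F_{y,v}(C_y) = 1{y↔v}`; `D_a = {x↮y}∩{x↮z}`, `W = D_a ∩ {o↔x}`, so `φ/μ(D_a) = 1{o↔y} − θ·1{x↔y}`).  If the
**hole-averaged exchange covariance** is nonnegative for every increasing `H`,
`INNER(H) := E[φ(C_y) H(C_y); y↮z] − E[(Aφ)(C_z)·(AH)(C_z); y↮z] ≥ 0`
(`(AH)(Z) = Σ_η weight(η) H(C_y(η ∖ Z̄))` the hole average; `INNER(H) = Σ_Z μ(C_z = Z; y↮z)·Cov_{G−V(Z)}(φ, H)`), then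
**S1-gen** holds for every increasing `G`:
`μ(W)·[μ(D)∫_{X∩D} G(C_y) − μ(X∩D)∫_D G(C_y)] ≤ μ(D_a)·[μ(D)∫_{{o↔y}∩D} G(C_y) − μ({o↔y}∩D)∫_D G(C_y)]`, `D = {y↮z}`.
Proof: `S(G) − S(TG) = μ(D)·INNER(G) ≥ 0` (`tel_identity`) along the increasing iterates `T^k G` (`tel_monotone_iter`),
so `S(G) ≥ S(T^K G) ≥ −2·((T^K G)(univ) − (T^K G)(∅)) ≥ −2ρ^K (G(univ) − G(∅)) → 0` (`tel_S_lower`, `tel_contract_iter`,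
`ρ = 1 − weight(∅) < 1`).
[cite: VandenbergHaggstromKahn2005, §1 pp. 7–8, display (10)] [cite: KozmaNitzan2024, Question 7 (p. 36)] -/
theorem exchS1_gen_of_innerHole (w : Sym2 (Fin n) → unitInterval) (o x y z : Fin n) (hw : ∀ e, (w e : ℝ) < 1)
    (hInner : ∀ H : Set (Sym2 (Fin n)) → ℝ, Monotone H →
      0 ≤ (∑ ω, wt⟦w⟧ ω * (((prodBernoulli w).real ((openConn x y)ᶜ ∩ (openConn x z)ᶜ) *
              connIndicatorFn y o (openEdgeCluster ω y) -
            (prodBernoulli w).real (((openConn x y)ᶜ ∩ (openConn x z)ᶜ) ∩ openConn o x) *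
              connIndicatorFn y x (openEdgeCluster ω y)) * H (openEdgeCluster ω y) * ind ((openConn y z)ᶜ) ω)) -
        ∑ ω, wt⟦w⟧ ω * ((hole⟦w, y, z, fun C : Set (Sym2 (Fin n)) =>
            (prodBernoulli w).real ((openConn x y)ᶜ ∩ (openConn x z)ᶜ) * connIndicatorFn y o C -
            (prodBernoulli w).real (((openConn x y)ᶜ ∩ (openConn x z)ᶜ) ∩ openConn o x) * connIndicatorFn y x C⟧)
              (openEdgeCluster ω z) *
          (hole⟦w, y, z, H⟧) (openEdgeCluster ω z) * ind ((openConn y z)ᶜ) ω)) :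
    ∀ G : Set (Sym2 (Fin n)) → ℝ, Monotone G →
      (prodBernoulli w).real (((openConn x y)ᶜ ∩ (openConn x z)ᶜ) ∩ openConn o x) *
          ((prodBernoulli w).real (openConn y z)ᶜ *
              (∫ ω in openConn x y ∩ (openConn y z)ᶜ, G (openEdgeCluster ω y) ∂(prodBernoulli w)) -
            (prodBernoulli w).real (openConn x y ∩ (openConn y z)ᶜ) *
              (∫ ω in (openConn y z)ᶜ, G (openEdgeCluster ω y) ∂(prodBernoulli w))) ≤
        (prodBernoulli w).real ((openConn x y)ᶜ ∩ (openConn x z)ᶜ) *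
          ((prodBernoulli w).real (openConn y z)ᶜ *
              (∫ ω in openConn o y ∩ (openConn y z)ᶜ, G (openEdgeCluster ω y) ∂(prodBernoulli w)) -
            (prodBernoulli w).real (openConn o y ∩ (openConn y z)ᶜ) *
              (∫ ω in (openConn y z)ᶜ, G (openEdgeCluster ω y) ∂(prodBernoulli w))) := by
  intro G hG
  set Da : ℝ := (prodBernoulli w).real ((openConn x y)ᶜ ∩ (openConn x z)ᶜ) with hDa
  set Aw : ℝ := (prodBernoulli w).real (((openConn x y)ᶜ ∩ (openConn x z)ᶜ) ∩ openConn o x) with hAw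
  set φ : Set (Sym2 (Fin n)) → ℝ := fun C => Da * connIndicatorFn y o C - Aw * connIndicatorFn y x C with hφ
  set D : Set (BondConfig (Fin n)) := (openConn y z)ᶜ with hD
  -- constants
  have hAw0 : 0 ≤ Aw := measureReal_nonneg
  have hAwDa : Aw ≤ Da := by rw [hAw, hDa]; exact measureReal_mono inter_subset_left
  have hDa1 : Da ≤ 1 := by rw [hDa]; exact measureReal_le_one
  have hcI : ∀ (v : Fin n) (C : Set (Sym2 (Fin n))), 0 ≤ connIndicatorFn y v C ∧ connIndicatorFn y v C ≤ 1 := by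
    intro v C
    unfold connIndicatorFn
    split_ifs
    · exact ⟨zero_le_one, le_rfl⟩
    · exact ⟨le_rfl, zero_le_one⟩
  have hφ1 : ∀ C, |φ C| ≤ 1 := by
    intro C
    rw [abs_le]
    have ho := hcI o C
    have hx := hcI x C
    simp only [hφ]
    constructor <;> nlinarith
  -- the S functional and its nonnegativity
  set d : ℝ := ∑ ω, wt⟦w⟧ ω * ind D ω with hd
  set EφG := ∑ ω, wt⟦w⟧ ω * (φ (openEdgeCluster ω y) * G (openEdgeCluster ω y) * ind D ω) with hEφG
  set Eφ := ∑ ω, wt⟦w⟧ ω * (φ (openEdgeCluster ω y) * ind D ω) with hEφ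
  set EG := ∑ ω, wt⟦w⟧ ω * (G (openEdgeCluster ω y) * ind D ω) with hEG
  have hS : 0 ≤ d * EφG - Eφ * EG := by
    set ρ : ℝ := 1 - wt⟦w⟧ (∅ : Set (Sym2 (Fin n))) with hρ
    set R : ℝ := G univ - G ∅ with hR
    have hR0 : 0 ≤ R := sub_nonneg.2 (hG (empty_subset _))
    have hρ0 : 0 ≤ ρ := by
      refine sub_nonneg.2 ?_
      simpa [tel_sum_weight w] using
        Finset.single_le_sum (fun η (_ : η ∈ Finset.univ) => tel_weight_nonneg w η) (Finset.mem_univ ∅)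
    have hρ1 : ρ < 1 := by linarith [tel_weight_empty_pos w hw]
    -- `S(G) ≥ −2 ρ^K R` for every `K`
    have hK : ∀ K : ℕ, -(2 * (ρ ^ K * R)) ≤ d * EφG - Eφ * EG := by
      intro K
      have h1 := tel_S_iter w y z φ hInner K G hG
      have hmono := tel_monotone_iter w y z K G hG
      have h2 := tel_S_lower w y z φ (((fun G : Set (Sym2 (Fin n)) → ℝ => resam⟦w, y, z, G⟧)^[K] G)) hφ1 hmono
      have h3 := tel_contract_iter w y z K G hG
      simp only [hd, hEφG, hEφ, hEG]
      linarith
    by_contra hneg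
    have hneg' : d * EφG - Eφ * EG < 0 := not_le.1 hneg
    rcases eq_or_lt_of_le hR0 with hR | hRpos
    · have := hK 0
      rw [← hR] at this
      simp at this
      linarith
    · have hpos : 0 < -(d * EφG - Eφ * EG) / (2 * R) := div_pos (by linarith) (by linarith)
      obtain ⟨K, hKρ⟩ := exists_pow_lt_of_lt_one hpos hρ1
      have := hK K
      have h4 : ρ ^ K * (2 * R) < -(d * EφG - Eφ * EG) := (lt_div_iff₀ (by linarith)).1 hKρ
      linarith
  -- rewrite the goal in the weighted-sum language
  have hqX : ∀ ω : BondConfig (Fin n), ind (openConn x y) ω = connIndicatorFn y x (openEdgeCluster ω y) := by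
    intro ω
    rw [connIndicatorFn_openEdgeCluster, knThm2_openConn_comm y x]
    by_cases h : ω ∈ (openConn x y : Set (BondConfig (Fin n)))
    · rw [indicator_of_mem h, ind_of_mem h, Pi.one_apply]
    · rw [indicator_of_notMem h, ind_of_not_mem h]
  have hqO : ∀ ω : BondConfig (Fin n), ind (openConn o y) ω = connIndicatorFn y o (openEdgeCluster ω y) := by
    intro ω
    rw [connIndicatorFn_openEdgeCluster, knThm2_openConn_comm y o]
    by_cases h : ω ∈ (openConn o y : Set (BondConfig (Fin n)))
    · rw [indicator_of_mem h, ind_of_mem h, Pi.one_apply]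
    · rw [indicator_of_notMem h, ind_of_not_mem h]
  rw [tel_setIntegral_eq_sum, tel_setIntegral_eq_sum, tel_setIntegral_eq_sum, tel_measureReal_eq_sum w (openConn y z)ᶜ,
    tel_measureReal_eq_sum w (openConn x y ∩ (openConn y z)ᶜ), tel_measureReal_eq_sum w (openConn o y ∩ (openConn y z)ᶜ)]
  simp only [ind_inter, hqX, hqO]
  -- the five sums of the goal
  set IXG := ∑ ω, wt⟦w⟧ ω * (G (openEdgeCluster ω y) * (connIndicatorFn y x (openEdgeCluster ω y) * ind D ω)) with hIXG
  set IOG := ∑ ω, wt⟦w⟧ ω * (G (openEdgeCluster ω y) * (connIndicatorFn y o (openEdgeCluster ω y) * ind D ω)) with hIOG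
  set mX := ∑ ω, wt⟦w⟧ ω * (connIndicatorFn y x (openEdgeCluster ω y) * ind D ω) with hmX
  set mO := ∑ ω, wt⟦w⟧ ω * (connIndicatorFn y o (openEdgeCluster ω y) * ind D ω) with hmO
  have e1 : EφG = Da * IOG - Aw * IXG := by
    rw [hEφG, hIOG, hIXG, Finset.mul_sum, Finset.mul_sum, ← Finset.sum_sub_distrib]
    exact Finset.sum_congr rfl fun ω _ => by simp only [hφ]; ring
  have e2 : Eφ = Da * mO - Aw * mX := by
    rw [hEφ, hmO, hmX, Finset.mul_sum, Finset.mul_sum, ← Finset.sum_sub_distrib]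
    exact Finset.sum_congr rfl fun ω _ => by simp only [hφ]; ring
  have key : Da * (d * IOG - mO * EG) - Aw * (d * IXG - mX * EG) = d * EφG - Eφ * EG := by
    rw [e1, e2]; ring
  linarith [key, hS]

end

end Summit.CriticalPhenomena.PercolationContinuityZ3.Theorems
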